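import Summits.CriticalPhenomena.SAWScalingLimit.Theses.SAWPoissonBanks
import Summits.CriticalPhenomena.SAWScalingLimit.Theorems.SubseqIdentification.Negative.ProbabilityRedundant
import Summits.CriticalPhenomena.SAWScalingLimit.Theorems.SimpleSubseqLimits.Negative.SimpleSubseqLimitsCore
import Literature.Probability.RandomPlanarGeometry.SAWScalingLimitFamily
import Literature.Probability.RandomPlanarGeometry.ConformalRestrictionProofs
import Mathlib.MeasureTheory.Measure.Portmanteau

/-!
# `SAWPoissonBanks.BanksOfLimit` (stmt-CriticalPhenomena-4778): the passage to the limit, given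
# restriction and boundary avoidance of the limit family

Route `SAWPoissonBanks` of `CriticalPhenomena/SAWScalingLimit`, support item `BanksOfLimit`:
`PoissonianBanks → ∀ P` chordal scaling-limit family of the critical `δℤ²` SAW, the exact
alternation tower `∏_{|S| odd} P D (E_B ∩ E_S) ≤ ∏_{|S| even} P D (E_B ∩ E_S)` holds for every
Dobrushin domain `D`, side `j`, base `B` and hull-complement family `F`, where
`E_{D'} = {γ | range γ ⊆ closure D'}` (`CurveClass.rangeSubset`).

## What is proved here

* `tendsto_map_law_of_null` — **portmanteau for the hull events.** If the pushed-forward critical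
  SAW laws `P_δ` of `(Ω_δ; a_δ, b_δ)` converge weakly to a probability measure `μ`, `C` is a closed
  event, `V ⊆ ℂ` is open, every curve class with trace in `closure Ω` and in `V` lies in `C`, and
  `μ (C ∖ {range ⊆ V}) = 0`, then `P_δ(C) → μ(C)` as `δ → 0⁺` (Billingsley's portmanteau theorem,
  both halves, through Mathlib's `tendsto_measure_of_le_liminf_measure_of_limsup_measure_le`; the
  lattice polylines live in `closure Ω`).
* `measure_rangeSubset_inter_touch_eq_zero` — **null touching from restriction + boundary
  avoidance.** If `P` has the restriction property and `P D'`-a.e. curve meets `∂D'` only at the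
  marked points, then `P D`-a.e. curve staying in `closure D'` meets `∂D'` only at the marked
  points (apply the restriction identity to the touching event).
* `banksOfLimit_of_restriction` — **the repaired item**: `PoissonianBanks`, chordality, the
  scaling-limit clause, `P.IsRestriction` and boundary avoidance of every `P D'` imply the exact
  alternation tower of `P` (products of finitely many convergent `[0, 1]`-valued sequences converge;
  `ENNReal.le_of_forall_pos_le_add`). An endpoint approximation of `D` exists by
  `SAW.exists_isEndpointApprox`.
* `BanksOfLimit_of_AxiomsOfLimit` — **`AxiomsOfLimit → BanksOfLimit`**: the two extra hypotheses
  are conclusions of the route's crux `AxiomsOfLimit` (stmt-CriticalPhenomena-1370), so in the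
  route's deciding theorem `closes` the hypothesis `h_BanksOfLimit` is redundant
  (`BanksOfLimit_of_AxiomsOfLimit h_AxiomsOfLimit`).

## Why the item is not closed as filed

As filed, `BanksOfLimit` quantifies over ALL chordal families `P` with the scaling-limit clause and
asks for the tower with no regularity of `P`. The passage to the limit of the probabilities of the
CLOSED events `E_B ∩ E_S` needs them to be `P D`-continuity sets (relative to curves in
`closure D`), i.e. the null-touching lemma, which the planner's own informal statement locates
"inside AxiomsOfLimit"; abstractly, weak limits of measures satisfying the asymptotic tower need
not satisfy it (mass on curves touching a hull boundary from inside). The present file supplies the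
proof under exactly the hypotheses the assembly has in hand.

## References

* P. Billingsley, *Convergence of probability measures*, 2nd ed. (1999), Thm. 2.1 (portmanteau).
* G. F. Lawler, O. Schramm, W. Werner, *Conformal restriction: the chordal case*, J. Amer. Math.
  Soc. 16 (2003), §3 (restriction identity applied to hull events).
* G. F. Lawler, O. Schramm, W. Werner, *On the scaling limit of planar self-avoiding walk* (2004),
  §3.4.5 (restriction property of the SAW scaling limit).
-/

noncomputable section

open MeasureTheory Filter Topology Set Metric
open scoped ENNReal NNReal BoundedContinuousFunction
open Literature.Probability.LatticeModels Literature.Probability.RandomPlanarGeometry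
  Literature.Probability.RandomPlanarGeometry.SAW
open Summit.CriticalPhenomena.SAWScalingLimit.Theses.SAWPoissonBanks

namespace Summit.CriticalPhenomena.SAWScalingLimit.Theorems

namespace SAWPoissonBanksBanksOfLimit

variable {D : DobrushinDomain} {a b : ℝ → Site 2} {μ : Measure (CurveClass ℂ)}

/-! ### Step 1: the pushed-forward SAW laws as probability measures; portmanteau -/

/-- Under an endpoint approximation the two lattice endpoints are eventually distinct (their
mesh points converge to the distinct marked points). [folklore] -/
theorem eventually_ne_of_isEndpointApprox (hab : IsEndpointApprox D a b) :
    ∀ᶠ δ in 𝓝[>] (0 : ℝ), a δ ≠ b δ := by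
  have hne : D.pt 0 ≠ D.pt 1 := fun h => absurd (D.pt_injective h) (by decide)
  obtain ⟨U, V, hU, hV, hxU, hyV, hUV⟩ := t2_separation hne
  filter_upwards [hab.tendsto_fst.eventually (hU.mem_nhds hxU),
    hab.tendsto_snd.eventually (hV.mem_nhds hyV)] with δ ha hb
  intro h
  rw [h] at ha
  exact Set.disjoint_iff.1 hUV ⟨ha, hb⟩

/-- **Weak convergence in Mathlib's form.** If the pushed-forward critical SAW laws of
`(Ω_δ; a_δ, b_δ)` converge to the probability measure `μ` on bounded continuous test functions
(`TendstoLaw`), then, replacing the finitely many junk laws by `μ`, one gets probability measures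
`ν δ`, eventually equal to the pushed-forward laws, with `ν δ → μ` in `ProbabilityMeasure`.
[cite: BillingsleyCPM1999, Thm. 2.1] -/
theorem exists_probabilityMeasure_tendsto (hab : IsEndpointApprox D a b) [IsProbabilityMeasure μ]
    (hlim : TendstoLaw (fun δ (γ : DomainSAW D.carrier δ (a δ) (b δ)) => γ.curve)
      (fun δ => law D.carrier δ (a δ) (b δ)) id μ) :
    ∃ ν : ℝ → ProbabilityMeasure (CurveClass ℂ),
      (∀ᶠ δ in 𝓝[>] (0 : ℝ), (ν δ : Measure (CurveClass ℂ)) =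
        (law D.carrier δ (a δ) (b δ)).map (fun γ => γ.curve)) ∧
      Tendsto ν (𝓝[>] (0 : ℝ)) (𝓝 ⟨μ, inferInstance⟩) := by
  classical
  let ν : ℝ → ProbabilityMeasure (CurveClass ℂ) := fun δ =>
    if h : IsProbabilityMeasure ((law D.carrier δ (a δ) (b δ)).map (fun γ => γ.curve)) then
      ⟨(law D.carrier δ (a δ) (b δ)).map (fun γ => γ.curve), h⟩ else ⟨μ, inferInstance⟩
  have hev : ∀ᶠ δ in 𝓝[>] (0 : ℝ), (ν δ : Measure (CurveClass ℂ)) =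
      (law D.carrier δ (a δ) (b δ)).map (fun γ => γ.curve) := by
    filter_upwards [SubseqIdentification.Negative.eventually_isProbabilityMeasure_law hab] with δ hδ
    haveI := hδ
    have h : IsProbabilityMeasure ((law D.carrier δ (a δ) (b δ)).map (fun γ => γ.curve)) :=
      Measure.isProbabilityMeasure_map (DomainSAW.measurable_of_top _).aemeasurable
    simp only [ν, dif_pos h, ProbabilityMeasure.coe_mk]
  refine ⟨ν, hev, ?_⟩
  rw [ProbabilityMeasure.tendsto_iff_forall_integral_tendsto]
  intro f
  have h1 := hlim f
  simp only [id] at h1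
  refine h1.congr' ?_
  filter_upwards [hev] with δ hδ
  rw [hδ, integral_map (DomainSAW.measurable_of_top _).aemeasurable
    f.continuous.aestronglyMeasurable]

/-- **Portmanteau for hull events.** Let the pushed-forward critical SAW laws `P_δ` of
`(Ω_δ; a_δ, b_δ)` converge weakly to the probability measure `μ`. If `C` is a closed event, `V` an
open subset of the plane such that every curve class with trace in `closure Ω ∩ V`… more
precisely with trace in `closure Ω` and in `V` … belongs to `C`, and `μ`-almost no curve of `C`
leaves `V`, then `P_δ(C) → μ(C)` as `δ → 0⁺`: the closed-set half of the portmanteau theorem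
bounds `limsup P_δ(C)`, the open-set half applied to `{range ⊆ V}` bounds `liminf`, the lattice
polylines having their traces in `closure Ω`. [cite: BillingsleyCPM1999, Thm. 2.1] -/
theorem tendsto_map_law_of_null (hab : IsEndpointApprox D a b) [IsProbabilityMeasure μ]
    (hlim : TendstoLaw (fun δ (γ : DomainSAW D.carrier δ (a δ) (b δ)) => γ.curve)
      (fun δ => law D.carrier δ (a δ) (b δ)) id μ)
    {C : Set (CurveClass ℂ)} {V : Set ℂ} (hC : IsClosed C) (hV : IsOpen V)
    (hVC : ∀ c : CurveClass ℂ, c.range ⊆ closure D.carrier → c.range ⊆ V → c ∈ C)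
    (hnull : μ (C \ CurveClass.rangeSubset V) = 0) :
    Tendsto (fun δ => ((law D.carrier δ (a δ) (b δ)).map (fun γ => γ.curve)) C)
      (𝓝[>] (0 : ℝ)) (𝓝 (μ C)) := by
  obtain ⟨ν, hev, hν⟩ := exists_probabilityMeasure_tendsto hab hlim
  have hUo : IsOpen (CurveClass.rangeSubset V) := CurveClass.isOpen_rangeSubset hV
  refine tendsto_measure_of_le_liminf_measure_of_limsup_measure_le
    (E₀ := C ∩ CurveClass.rangeSubset V) (E₁ := C) inter_subset_left subset_rfl ?_ ?_ ?_
  · rwa [show C \ (C ∩ CurveClass.rangeSubset V) = C \ CurveClass.rangeSubset V from by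
      ext x; simp only [Set.mem_sdiff, mem_inter_iff]; tauto]
  · have hopen := ProbabilityMeasure.le_liminf_measure_open_of_tendsto hν hUo
    calc μ (C ∩ CurveClass.rangeSubset V) ≤ μ (CurveClass.rangeSubset V) :=
          measure_mono inter_subset_right
      _ ≤ liminf (fun δ => (ν δ : Measure (CurveClass ℂ)) (CurveClass.rangeSubset V))
          (𝓝[>] (0 : ℝ)) := hopen
      _ = liminf (fun δ => ((law D.carrier δ (a δ) (b δ)).map (fun γ => γ.curve))
          (C ∩ CurveClass.rangeSubset V)) (𝓝[>] (0 : ℝ)) := liminf_congr ?_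
    filter_upwards [hev, eventually_ne_of_isEndpointApprox hab] with δ hδ hne
    rw [hδ, Measure.map_apply (DomainSAW.measurable_of_top _) hUo.measurableSet,
      Measure.map_apply (DomainSAW.measurable_of_top _)
        (hC.measurableSet.inter hUo.measurableSet)]
    congr 1
    ext γ
    simp only [mem_preimage, mem_inter_iff, CurveClass.mem_rangeSubset]
    exact ⟨fun h => ⟨hVC _ (SimpleSubseqLimits.Negative.curve_range_subset_closure hne γ) h, h⟩,
      fun h => h.2⟩
  · have hclosed := ProbabilityMeasure.limsup_measure_closed_le_of_tendsto hν hC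
    calc limsup (fun δ => ((law D.carrier δ (a δ) (b δ)).map (fun γ => γ.curve)) C)
          (𝓝[>] (0 : ℝ))
          = limsup (fun δ => (ν δ : Measure (CurveClass ℂ)) C) (𝓝[>] (0 : ℝ)) :=
          limsup_congr (by filter_upwards [hev] with δ hδ; rw [hδ])
      _ ≤ μ C := hclosed

/-! ### Step 2: null touching from restriction and boundary avoidance -/

/-- The **touching event** of a Dobrushin domain `D'` — the trace meets `∂D'` elsewhere than at
the two marked points, `{c | ¬ (range c ∩ ∂D' ⊆ {a', b'})}` — is Borel. [folklore] -/
theorem measurableSet_touch (D' : DobrushinDomain) :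
    MeasurableSet {c : CurveClass ℂ | ¬ (c.range ∩ frontier D'.carrier ⊆ {D'.pt 0, D'.pt 1})} :=
  (CurveClass.measurableSet_range_inter_subset isClosed_frontier
    ((Set.finite_singleton _).insert _).isClosed).compl

/-- **Null touching.** If `P` has the restriction property and `P D'`-almost every curve meets
`∂D'` only at the marked points, then for `D' ⊆ D` with the same marked points, `P D`-almost no
curve staying in `closure D'` touches `∂D'` away from the marked points: by the restriction
identity `P D (touch ∩ {γ ⊆ cl D'}) = P D' (touch) · P D {γ ⊆ cl D'} = 0`.
[cite: LawlerSchrammWerner2003Restriction, §3] -/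
theorem measure_rangeSubset_inter_touch_eq_zero {P : ChordalFamily} (hR : P.IsRestriction)
    {D D' : DobrushinDomain} (hsub : D'.carrier ⊆ D.carrier) (h0 : D'.pt 0 = D.pt 0)
    (h1 : D'.pt 1 = D.pt 1)
    (hbdry : ∀ᵐ γ ∂(P D'), γ.range ∩ frontier D'.carrier ⊆ {D'.pt 0, D'.pt 1}) :
    P D (CurveClass.rangeSubset (closure D'.carrier) ∩
      {c : CurveClass ℂ | ¬ (c.range ∩ frontier D'.carrier ⊆ {D'.pt 0, D'.pt 1})}) = 0 := by
  have h := hR D D' hsub h0 h1 _ (measurableSet_touch D')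
  have h0' : P D' {c : CurveClass ℂ | ¬ (c.range ∩ frontier D'.carrier ⊆ {D'.pt 0, D'.pt 1})} =
      0 := ae_iff.1 hbdry
  rw [h0', zero_mul] at h
  rw [inter_comm]
  exact h.symm

/-! ### Step 3: the collar of a hull complement -/

/-- The **collar** `D' ∪ B(a, ε) ∪ B(b, ε)` of a sub-domain `D'` of `D` agreeing with `D` in the
`ε`-balls at the marked points: a point of `closure D` in the collar lies in `closure D'`.
[folklore] -/
theorem mem_closure_of_mem_collar {D D' : DobrushinDomain} {ε : ℝ}
    (hε0 : D'.carrier ∩ ball (D.pt 0) ε = D.carrier ∩ ball (D.pt 0) ε)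
    (hε1 : D'.carrier ∩ ball (D.pt 1) ε = D.carrier ∩ ball (D.pt 1) ε)
    {z : ℂ} (hz : z ∈ closure D.carrier)
    (hzV : z ∈ D'.carrier ∪ ball (D.pt 0) ε ∪ ball (D.pt 1) ε) : z ∈ closure D'.carrier := by
  rcases hzV with (hz' | hz0) | hz1
  · exact subset_closure hz'
  · have h : z ∈ closure (ball (D.pt 0) ε ∩ D.carrier) := isOpen_ball.inter_closure ⟨hz0, hz⟩
    rw [inter_comm, ← hε0] at h
    exact closure_mono inter_subset_left h
  · have h : z ∈ closure (ball (D.pt 1) ε ∩ D.carrier) := isOpen_ball.inter_closure ⟨hz1, hz⟩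
    rw [inter_comm, ← hε1] at h
    exact closure_mono inter_subset_left h

/-- A point of `closure D'` outside the collar is a boundary point of `D'` other than the two
marked points. [folklore] -/
theorem mem_frontier_of_not_mem_collar {D D' : DobrushinDomain} {ε : ℝ} (hε : 0 < ε)
    (h0 : D'.pt 0 = D.pt 0) (h1 : D'.pt 1 = D.pt 1)
    {z : ℂ} (hz : z ∈ closure D'.carrier)
    (hzV : z ∉ D'.carrier ∪ ball (D.pt 0) ε ∪ ball (D.pt 1) ε) :
    z ∈ frontier D'.carrier ∧ z ∉ ({D'.pt 0, D'.pt 1} : Set ℂ) := by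
  simp only [mem_union, not_or] at hzV
  obtain ⟨⟨hzD', hz0⟩, hz1⟩ := hzV
  refine ⟨?_, ?_⟩
  · rw [D'.isOpen.frontier_eq]
    exact ⟨hz, hzD'⟩
  · rintro (rfl | rfl)
    · exact hz0 (h0 ▸ mem_ball_self hε)
    · exact hz1 (h1 ▸ mem_ball_self hε)

/-! ### Step 4: the repaired item and `AxiomsOfLimit → BanksOfLimit` -/

/-- **`BanksOfLimit` under restriction and boundary avoidance (the repaired support item).**
Assume `PoissonianBanks`; let `P` be a chordal family which is the scaling limit of the critical
SAW laws in every Dobrushin domain along every endpoint approximation, has the restriction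
property, and whose every law `P D'` is carried by curves meeting `∂D'` only at the marked points.
Then for every Dobrushin domain `D`, side `j`, base `B` and hull complements `F₀, …, F_n` of `D` on
side `j`, `∏_{|S| odd} P D (E_B ∩ E_S) ≤ ∏_{|S| even} P D (E_B ∩ E_S)`. Proof: choose an endpoint
approximation of `D` (`SAW.exists_isEndpointApprox`); every event `E_B ∩ E_S` is closed, contains
every lattice curve whose trace lies in the open collar `V_S` of `cl B ∩ ⋂ cl F_i`, and its part
outside `{range ⊆ V_S}` consists of curves touching `∂B` or some `∂F_i` away from `a, b`, a
`P D`-null event (`measure_rangeSubset_inter_touch_eq_zero`); so `P_δ(E_B ∩ E_S) → P D(E_B ∩ E_S)`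
(`tendsto_map_law_of_null`), finite products converge, and the asymptotic tower of
`PoissonianBanks` passes to the limit for every `ε > 0`. [cite: BillingsleyCPM1999, Thm. 2.1] -/
theorem banksOfLimit_of_restriction (hPB : PoissonianBanks) (P : ChordalFamily) (hP : P.IsChordal)
    (hlim : ∀ (D : DobrushinDomain) (a b : ℝ → Site 2), IsEndpointApprox D a b →
      TendstoLaw (fun δ (γ : DomainSAW D.carrier δ (a δ) (b δ)) => γ.curve)
        (fun δ => law D.carrier δ (a δ) (b δ)) id (P D))
    (hR : P.IsRestriction)
    (hbdry : ∀ D : DobrushinDomain, ∀ᵐ γ ∂(P D), γ.range ∩ frontier D.carrier ⊆ {D.pt 0, D.pt 1})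
    (D : DobrushinDomain) (j : Fin 2) (B : DobrushinDomain) (n : ℕ)
    (F : Fin (n + 1) → DobrushinDomain)
    (hB : B.carrier ⊆ D.carrier ∧ B.pt 0 = D.pt 0 ∧ B.pt 1 = D.pt 1 ∧
      D.arc j ⊆ frontier B.carrier ∧ (∃ ε : ℝ, 0 < ε ∧
        B.carrier ∩ Metric.ball (D.pt 0) ε = D.carrier ∩ Metric.ball (D.pt 0) ε ∧
        B.carrier ∩ Metric.ball (D.pt 1) ε = D.carrier ∩ Metric.ball (D.pt 1) ε))
    (hF : ∀ i, ((F i).carrier ⊆ D.carrier ∧ (F i).pt 0 = D.pt 0 ∧ (F i).pt 1 = D.pt 1 ∧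
      D.arc j ⊆ frontier (F i).carrier ∧ (∃ ε : ℝ, 0 < ε ∧
        (F i).carrier ∩ Metric.ball (D.pt 0) ε = D.carrier ∩ Metric.ball (D.pt 0) ε ∧
        (F i).carrier ∩ Metric.ball (D.pt 1) ε = D.carrier ∩ Metric.ball (D.pt 1) ε))) :
    (∏ S ∈ (Finset.univ : Finset (Finset (Fin (n + 1)))).filter (fun S => Odd S.card),
      P D (CurveClass.rangeSubset (closure B.carrier) ∩
        ⋂ i ∈ S, CurveClass.rangeSubset (closure (F i).carrier))) ≤
    (∏ S ∈ (Finset.univ : Finset (Finset (Fin (n + 1)))).filter (fun S => Even S.card),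
      P D (CurveClass.rangeSubset (closure B.carrier) ∩
        ⋂ i ∈ S, CurveClass.rangeSubset (closure (F i).carrier))) := by
  obtain ⟨a, b, hab⟩ := exists_isEndpointApprox D
  haveI : IsProbabilityMeasure (P D) := (hP D).1
  obtain ⟨hBsub, hB0, hB1, hBarc, εB, hεB, hεB0, hεB1⟩ := hB
  choose hFsub hF0 hF1 hFarc εF hεF hεF0 hεF1 using hF
  -- the events and their collars
  set C : Finset (Fin (n + 1)) → Set (CurveClass ℂ) := fun S =>
    CurveClass.rangeSubset (closure B.carrier) ∩
      ⋂ i ∈ S, CurveClass.rangeSubset (closure (F i).carrier) with hC_def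
  have hconv : ∀ S : Finset (Fin (n + 1)),
      Tendsto (fun δ => ((law D.carrier δ (a δ) (b δ)).map (fun γ => γ.curve)) (C S))
        (𝓝[>] (0 : ℝ)) (𝓝 (P D (C S))) := by
    intro S
    have hCclosed : IsClosed (C S) :=
      (CurveClass.isClosed_rangeSubset isClosed_closure).inter
        (isClosed_iInter fun i => isClosed_iInter fun _ =>
          CurveClass.isClosed_rangeSubset isClosed_closure)
    set V : Set ℂ := (B.carrier ∪ ball (D.pt 0) εB ∪ ball (D.pt 1) εB) ∩
      ⋂ i ∈ S, ((F i).carrier ∪ ball (D.pt 0) (εF i) ∪ ball (D.pt 1) (εF i)) with hV_def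
    have hVopen : IsOpen V :=
      ((B.isOpen.union isOpen_ball).union isOpen_ball).inter
        (isOpen_biInter_finset fun i _ => ((F i).isOpen.union isOpen_ball).union isOpen_ball)
    refine tendsto_map_law_of_null hab (hlim D a b hab) hCclosed hVopen ?_ ?_
    · -- lattice curves in the collar lie in the event
      intro c hcD hcV
      refine ⟨fun z hz => mem_closure_of_mem_collar hεB0 hεB1 (hcD hz) (hcV hz).1, ?_⟩
      simp only [mem_iInter, CurveClass.mem_rangeSubset]
      intro i hi z hz
      exact mem_closure_of_mem_collar (hεF0 i) (hεF1 i) (hcD hz) ((mem_iInter₂.1 (hcV hz).2) i hi)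
    · -- curves of the event leaving the collar touch a hull boundary: a null event
      have hsub : C S \ CurveClass.rangeSubset V ⊆
          (CurveClass.rangeSubset (closure B.carrier) ∩
            {c : CurveClass ℂ | ¬ (c.range ∩ frontier B.carrier ⊆ {B.pt 0, B.pt 1})}) ∪
            ⋃ i : Fin (n + 1), (CurveClass.rangeSubset (closure (F i).carrier) ∩
              {c : CurveClass ℂ |
                ¬ (c.range ∩ frontier (F i).carrier ⊆ {(F i).pt 0, (F i).pt 1})}) := by
        rintro c ⟨hcC, hcV⟩
        simp only [CurveClass.mem_rangeSubset, not_subset] at hcV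
        obtain ⟨z, hz, hzV⟩ := hcV
        have hcB : c.range ⊆ closure B.carrier := hcC.1
        have hcF : ∀ i ∈ S, c.range ⊆ closure (F i).carrier := fun i hi =>
          (mem_iInter₂.1 hcC.2) i hi
        simp only [hV_def, mem_inter_iff, mem_iInter, not_and_or, not_forall] at hzV
        rcases hzV with hzB | ⟨i, hi, hzF⟩
        · refine Or.inl ⟨hcB, ?_⟩
          obtain ⟨hfr, hne⟩ := mem_frontier_of_not_mem_collar hεB hB0 hB1 (hcB hz) hzB
          exact fun h => hne (h ⟨hz, hfr⟩)
        · refine Or.inr (mem_iUnion.2 ⟨i, hcF i hi, ?_⟩)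
          obtain ⟨hfr, hne⟩ :=
            mem_frontier_of_not_mem_collar (hεF i) (hF0 i) (hF1 i) (hcF i hi hz) hzF
          exact fun h => hne (h ⟨hz, hfr⟩)
      refine measure_mono_null hsub (measure_union_null ?_ ?_)
      · exact measure_rangeSubset_inter_touch_eq_zero hR hBsub hB0 hB1 (hbdry B)
      · exact (measure_iUnion_null_iff.2 fun i =>
          measure_rangeSubset_inter_touch_eq_zero hR (hFsub i) (hF0 i) (hF1 i) (hbdry (F i)))
  have hprod : ∀ T : Finset (Finset (Fin (n + 1))),
      Tendsto (fun δ => ∏ S ∈ T, ((law D.carrier δ (a δ) (b δ)).map (fun γ => γ.curve)) (C S))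
        (𝓝[>] (0 : ℝ)) (𝓝 (∏ S ∈ T, P D (C S))) := fun T =>
    ENNReal.tendsto_finsetProd_of_ne_top T (fun S _ => hconv S) fun S _ => measure_ne_top _ _
  refine ENNReal.le_of_forall_pos_le_add fun ε hε _ => ?_
  have hev := hPB D a b hab j B n F ⟨hBsub, hB0, hB1, hBarc, εB, hεB, hεB0, hεB1⟩
    (fun i => ⟨hFsub i, hF0 i, hF1 i, hFarc i, εF i, hεF i, hεF0 i, hεF1 i⟩) ε
    (ENNReal.coe_pos.2 hε)
  exact le_of_tendsto_of_tendsto (hprod _) ((hprod _).add tendsto_const_nhds) hev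

/-- **`AxiomsOfLimit → BanksOfLimit`.** The restriction property and the simplicity / boundary
avoidance clause delivered by the route's crux `AxiomsOfLimit` (stmt-CriticalPhenomena-1370) for
every chordal scaling-limit family are exactly the extra hypotheses of
`banksOfLimit_of_restriction`; hence the support item `BanksOfLimit` (stmt-CriticalPhenomena-4778)
follows from `AxiomsOfLimit`, and in the deciding theorem `SAWPoissonBanks.closes` the hypothesis
`h_BanksOfLimit` may be replaced by `BanksOfLimit_of_AxiomsOfLimit h_AxiomsOfLimit`.
[cite: BillingsleyCPM1999, Thm. 2.1] -/
theorem BanksOfLimit_of_AxiomsOfLimit (hA : AxiomsOfLimit) : BanksOfLimit := by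
  unfold BanksOfLimit
  intro hPB P hP hlim D j B n F hB hF
  obtain ⟨hR, -, -, -, -, hsimple⟩ := hA P hP hlim
  exact banksOfLimit_of_restriction hPB P hP hlim hR
    (fun D' => (hsimple D').mono fun γ h => h.2) D j B n F hB hF

end SAWPoissonBanksBanksOfLimit

end Summit.CriticalPhenomena.SAWScalingLimit.Theorems

end
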